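import Summits.ABC.ABC.Theses.IsogenyGlueCongruence
import Summits.ABC.ABC.Theorems.IsogenyGlueCongruenceDegreePrimesPolyBoundedStubSpectral
import Summits.ABC.ABC.Theorems.IsogenyGlueCongruenceDegreePrimesPolyBoundedStubMinimalPrimes
import Literature.NumberTheory.EllipticCurves.PastenSpectralDegree
import Literature.NumberTheory.EllipticCurves.PastenCongruenceModulusProofs
import Literature.NumberTheory.EllipticCurves.PastenValuationProduct
import Literature.NumberTheory.EllipticCurves.NewformsLevelRaising
import HarnessLib

/-!
# Crux A `DegreePrimesPolyBounded` (stmt-ABC-2045) — line `Sketch`, skeleton v3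

Composition `DegreePrimesPolyBounded_of` = the PROVABLE glue stub `stub_glue` applied to:

* `stub_datum`          — semistable globally minimal `W` carry a datum at level `N_W`
  (fact `nonempty_modularParametrizationData`, BCDT + Edixhoven) [fact-shaped, blocked];
* `stub_mazurKenku`     — `= PastenShimura2024_minimalDegree_le_163_mul` (Mazur–Kenku; the tree's
  `PastenShimura2024_exists_datum_modularDegree_eq_mul_of` (p86407) gives the product form
  "`W` carries a datum of degree `k·δ`, `k ≤ 163`") [fact-shaped, blocked on
  `mazurKenku_exists_cyclic_isogeny`];
* `stub_spectral`       — `= PastenShimura2024_thm_5_5` [CLOSED p86085, imported];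
* `stub_minimalPrimes`  — Atkin–Lehner–Li classification of minimal primes of `𝕋_N`
  [CLOSED p86417, imported];
* `stub_oldLevelCongruence` — Galois input of the old-partner peeling (Carayol mod-λ reps,
  Chebotarev–Brauer–Nesbitt, Mazur irreducibility `ℓ ≥ 11`, Tate curve), Hecke-ring phrasing
  [fact-shaped, blocked: sub-facts E1/E3/E4/E5 missing from the tree] and
  `stub_oldPartner_of` — it implies the peeling [PROVED, to land];
* `stub_pastenSzpiro`   — `= pasten_thm_7_5` (`log Δ_min < (1/4+ε) N log N`) [fact-shaped,
  blocked] and `stub_discValuation_of_pasten_thm_7_5` — it implies `v_p(Δ_min) ≤ C N²`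
  (Shafarevich below the threshold) [PROVED, to land];
* `stub_smallSeparators` — THE BET, E-free: small Hecke separators between a rational newform and
  any other newform of the same level (card `hasse-separator-transference`);
* `stub_glue` — (all the statements) ⟹ crux A, through the E-free transfer (Pasten Prop 5.4 +
  Hasse) [PROVED, to land].
-/

set_option linter.dupNamespace false

noncomputable section

open scoped MatrixGroups ModularForm
open CongruenceSubgroup
open Literature.NumberTheory.EllipticCurves.ModularForms
open Summit.ABC.ABC.Theses.IsogenyGlueCongruence

namespace Summit.ABC.ABC.Theorems.DegreePrimesPolyBounded

/-! ## Stubs -/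

/-- STUB (fact-shaped; BCDT 2001 + Edixhoven 1991): semistable globally minimal elliptic curves over
`ℚ` carry a modular parametrisation datum at level `N_W`. -/
theorem stub_datum :
    ∀ (W : WeierstrassCurve ℚ) [W.IsElliptic] [W.IsGloballyMinimal] [NeZero (W.conductorNorm ℤ)],
      W.IsSemistable ℤ → Nonempty (ModularParametrizationData W (W.conductorNorm ℤ)) := by
  sorry

/-- STUB (fact-shaped; Mazur 1978 + Kenku 1982 via Pasten 2024 §3 p. 13): the minimal
parametrisation degree of a globally minimal curve of the class is `≤ 163 · δ`. -/
theorem stub_mazurKenku : PastenShimura2024_minimalDegree_le_163_mul := by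
  sorry

/-- STUB (fact-shaped; Ribet 1990 §§1–2, Darmon–Diamond–Taylor 1995 Prop. 2.12(c): Carayol mod-λ
representations + Chebotarev–Brauer–Nesbitt + Mazur 1978 + Tate curve): old-level congruence primes
`ℓ ≥ 11`, `ℓ ∤ N`, divide the Tamagawa exponent `v_p(Δ_min(W))` at a prime `p ∣ N`, `p ∤ M`. -/
theorem stub_oldLevelCongruence :
    ∀ (N : ℕ) [NeZero N] (W : WeierstrassCurve ℚ) [W.IsElliptic] [W.IsGloballyMinimal],
    W.IsSemistable ℤ → W.conductorNorm ℤ = N →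
    ∀ (f : CuspForm (Gamma0 N) 2), IsNewformOf W f →
    ∀ (M : ℕ) [NeZero M] (hM : M ∣ N) (g : CuspForm (Gamma0 M) 2), IsNewform0 g →
    ∀ (p ℓ : ℕ), p.Prime → ℓ.Prime → p ∣ N → ¬ p ∣ M → ¬ ℓ ∣ N → 11 ≤ ℓ →
    ∀ 𝔪 : Ideal (anemicHeckeRing N 2), 𝔪.IsMaximal → (ℓ : anemicHeckeRing N 2) ∈ 𝔪 →
      eigenIdeal f ≤ 𝔪 → eigenIdeal (toLevel0 hM 2 g) ≤ 𝔪 →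
      ℓ ∣ (W.minimalDiscriminantNorm ℤ).factorization p := by
  sorry

/-- STUB (PROVED by the line's worker, to land): the old-partner peeling from the Galois input
(`ℓ ∣ η ≠ 0` ⟹ maximal `𝔪 ∋ ℓ` over `𝕀_f + 𝕀_g`; squarefree conductor; `p ∣ N`, `p ∤ M`;
`v_p(Δ_min) > 0`). -/
theorem stub_oldPartner_of
    (hGal : ∀ (N : ℕ) [NeZero N] (W : WeierstrassCurve ℚ) [W.IsElliptic] [W.IsGloballyMinimal],
          W.IsSemistable ℤ → W.conductorNorm ℤ = N →
          ∀ (f : CuspForm (Gamma0 N) 2), IsNewformOf W f →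
          ∀ (M : ℕ) [NeZero M] (hM : M ∣ N) (g : CuspForm (Gamma0 M) 2), IsNewform0 g →
          ∀ (p ℓ : ℕ), p.Prime → ℓ.Prime → p ∣ N → ¬ p ∣ M → ¬ ℓ ∣ N → 11 ≤ ℓ →
          ∀ 𝔪 : Ideal (anemicHeckeRing N 2), 𝔪.IsMaximal → (ℓ : anemicHeckeRing N 2) ∈ 𝔪 →
            eigenIdeal f ≤ 𝔪 → eigenIdeal (toLevel0 hM 2 g) ≤ 𝔪 →
            ℓ ∣ (W.minimalDiscriminantNorm ℤ).factorization p) :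
    ∀ (N : ℕ) [NeZero N] (W : WeierstrassCurve ℚ) [W.IsElliptic] [W.IsGloballyMinimal],
      W.IsSemistable ℤ → W.conductorNorm ℤ = N →
      ∀ (D : ModularParametrizationData W N) (M : ℕ) [NeZero M] (hM : M ∣ N), M ≠ N →
      ∀ g : CuspForm (Gamma0 M) 2, IsNewform0 g →
      ∀ ℓ : ℕ, ℓ.Prime →
        heckeCongruenceModulus D.f (eigenIdeal (toLevel0 hM 2 g)) ≠ 0 →
        ℓ ∣ heckeCongruenceModulus D.f (eigenIdeal (toLevel0 hM 2 g)) →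
        (∃ p : ℕ, p.Prime ∧ p ∣ N ∧ 0 < (W.minimalDiscriminantNorm ℤ).factorization p ∧
            ℓ ∣ (W.minimalDiscriminantNorm ℤ).factorization p) ∨ ℓ ∣ N ∨ ℓ < 11 := by
  sorry

/-- STUB (fact-shaped; Pasten 2024 Thm 7.5, classical modular approach): `log Δ_min(E) <
(1/4 + ε) N log N` for `N ≥ N₀(ε)`. -/
theorem stub_pastenSzpiro : Literature.NumberTheory.EllipticCurves.pasten_thm_7_5 := by
  sorry

/-- STUB (PROVED by the line's worker, to land): Pasten's Thm 7.5 with Shafarevich's finiteness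
below the threshold gives `v_p(Δ_min(W)) ≤ C · N_W²`. -/
theorem stub_discValuation_of_pasten_thm_7_5
    (h : Literature.NumberTheory.EllipticCurves.pasten_thm_7_5) :
    ∃ κ C : ℝ, ∀ (W : WeierstrassCurve ℚ) [W.IsElliptic] [W.IsGloballyMinimal]
      [NeZero (W.conductorNorm ℤ)], W.IsSemistable ℤ → ∀ p : ℕ,
        (((W.minimalDiscriminantNorm ℤ).factorization p : ℕ) : ℝ) ≤
          C * (W.conductorNorm ℤ : ℝ) ^ κ := by
  sorry

/-- STUB — THE BET, E-free (card `hasse-separator-transference`, C⁺₂ in Hecke-ring form,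
prime-supported; stated at all levels for uniformity, consumed only at squarefree level): two
newforms `f ≠ g` of level `N`, `f` rational, are separated by an integral combination
`t = Σ_{p ∈ S} u_p T_p`, `S` a set of primes `p ≤ C N^A`, `p ∤ N`, `|u_p| ≤ C N^A`, with
`t ∈ 𝕀_g ∖ 𝕀_f`.  No elliptic curve, height or period occurs. -/
theorem stub_smallSeparators :
    ∃ A C : ℝ, ∀ (N : ℕ) [NeZero N] (f g : CuspForm (Gamma0 N) 2), IsNewform0 f →
      IsNewform0 g → HasIntegralEigenvalues f → eigenIdeal f ≠ eigenIdeal g →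
      ∃ (S : Finset ℕ) (u : ℕ → ℤ) (hS : ∀ p ∈ S, p.Prime ∧ ¬ p ∣ N),
        (∀ p ∈ S, (p : ℝ) ≤ C * (N : ℝ) ^ A) ∧ (∀ p ∈ S, |(u p : ℝ)| ≤ C * (N : ℝ) ^ A) ∧
        (∑ p ∈ S.attach, u p •
            @anemicHeckeRing.T N _ 2 (p : ℕ) ⟨(hS p p.2).1.ne_zero⟩ (hS p p.2).1 (hS p p.2).2) ∈
          eigenIdeal g ∧
        (∑ p ∈ S.attach, u p •
            @anemicHeckeRing.T N _ 2 (p : ℕ) ⟨(hS p p.2).1.ne_zero⟩ (hS p p.2).1 (hS p p.2).2) ∉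
          eigenIdeal f := by
  sorry

/-- STUB (PROVED, to land) — the glue of line `Sketch`: all statements above imply crux A
(E-free transfer by Pasten Prop 5.4 + Hasse; classification; peeling; constants
`κ = max(κ₅, 3A, 1)`, `C = max C₅ 0 + 4 (max C₆ 1)³ + 163`). -/
theorem stub_glue :
    (∀ (W : WeierstrassCurve ℚ) [W.IsElliptic] [W.IsGloballyMinimal] [NeZero (W.conductorNorm ℤ)],
      W.IsSemistable ℤ → Nonempty (ModularParametrizationData W (W.conductorNorm ℤ))) →
    PastenShimura2024_minimalDegree_le_163_mul →
    PastenShimura2024_thm_5_5 →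
    (∀ (N : ℕ) [NeZero N] (P : Ideal (anemicHeckeRing N 2)),
      P ∈ minimalPrimes (anemicHeckeRing N 2) →
      (∃ g : CuspForm (Gamma0 N) 2, IsNewform0 g ∧ P = eigenIdeal g) ∨
      (∃ (M : ℕ) (_ : NeZero M) (hM : M ∣ N), M ≠ N ∧ ∃ g : CuspForm (Gamma0 M) 2,
        IsNewform0 g ∧ P = eigenIdeal (toLevel0 hM 2 g))) →
    (∀ (N : ℕ) [NeZero N] (W : WeierstrassCurve ℚ) [W.IsElliptic] [W.IsGloballyMinimal],
      W.IsSemistable ℤ → W.conductorNorm ℤ = N →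
      ∀ (D : ModularParametrizationData W N) (M : ℕ) [NeZero M] (hM : M ∣ N), M ≠ N →
      ∀ g : CuspForm (Gamma0 M) 2, IsNewform0 g →
      ∀ ℓ : ℕ, ℓ.Prime →
        heckeCongruenceModulus D.f (eigenIdeal (toLevel0 hM 2 g)) ≠ 0 →
        ℓ ∣ heckeCongruenceModulus D.f (eigenIdeal (toLevel0 hM 2 g)) →
        (∃ p : ℕ, p.Prime ∧ p ∣ N ∧ 0 < (W.minimalDiscriminantNorm ℤ).factorization p ∧
            ℓ ∣ (W.minimalDiscriminantNorm ℤ).factorization p) ∨ ℓ ∣ N ∨ ℓ < 11) →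
    (∃ κ C : ℝ, ∀ (W : WeierstrassCurve ℚ) [W.IsElliptic] [W.IsGloballyMinimal]
      [NeZero (W.conductorNorm ℤ)], W.IsSemistable ℤ → ∀ p : ℕ,
        (((W.minimalDiscriminantNorm ℤ).factorization p : ℕ) : ℝ) ≤
          C * (W.conductorNorm ℤ : ℝ) ^ κ) →
    (∃ A C : ℝ, ∀ (N : ℕ) [NeZero N] (f g : CuspForm (Gamma0 N) 2), IsNewform0 f →
      IsNewform0 g → HasIntegralEigenvalues f → eigenIdeal f ≠ eigenIdeal g →
      ∃ (S : Finset ℕ) (u : ℕ → ℤ) (hS : ∀ p ∈ S, p.Prime ∧ ¬ p ∣ N),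
        (∀ p ∈ S, (p : ℝ) ≤ C * (N : ℝ) ^ A) ∧ (∀ p ∈ S, |(u p : ℝ)| ≤ C * (N : ℝ) ^ A) ∧
        (∑ p ∈ S.attach, u p •
            @anemicHeckeRing.T N _ 2 (p : ℕ) ⟨(hS p p.2).1.ne_zero⟩ (hS p p.2).1 (hS p p.2).2) ∈
          eigenIdeal g ∧
        (∑ p ∈ S.attach, u p •
            @anemicHeckeRing.T N _ 2 (p : ℕ) ⟨(hS p p.2).1.ne_zero⟩ (hS p p.2).1 (hS p p.2).2) ∉
          eigenIdeal f) →
    DegreePrimesPolyBounded := by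
  sorry

/-! ## Composition -/

/-- **Crux A from the stubs.** -/
theorem DegreePrimesPolyBounded_of : DegreePrimesPolyBounded :=
  stub_glue stub_datum stub_mazurKenku stub_spectral stub_minimalPrimes
    (stub_oldPartner_of stub_oldLevelCongruence)
    (stub_discValuation_of_pasten_thm_7_5 stub_pastenSzpiro) stub_smallSeparators

end Summit.ABC.ABC.Theorems.DegreePrimesPolyBounded

end
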